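import Summits.AtomisticToContinuum.Crystallization.Theorems.ChargedEnergyGapKinkCertB
import HarnessLib

/-!
# Charged energy gap — KINK CERTIFICATES, file B part 2/4: §S3 semantics · §S4 membership of tightening, root, splits · §S5 the L leaf

student team «lens-3» (decomposition, residual mode), generation 84, NODE 85 «KinkCert»; namespace `…Theorems.ChargedEnergyGapChartDial`.
Continuation of `…ChargedEnergyGapKinkCertB` (see its module docstring for the design of the reflected checker `kcCheck` and the plan of the
soundness proof §S1–§S10); this part is the verbatim continuation of the single development, cut at section boundaries for the 400-line cap.
Imports ONLY the previous part and `HarnessLib`; no `set_option`, no `sorry`, no instance, no notation, no `private`, no `native_decide`.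
-/

namespace Summit.AtomisticToContinuum.Crystallization.Theorems.ChargedEnergyGapChartDial

/-! ## §S3 Semantics: configurations, hypotheses, membership -/

/-- a three-hole configuration: slope bound `ρ`, gap step counts `n₁ n₂`, per hole depth `e`, missing-row depth `m`, kink parts `a b`. -/
structure KcConf where
  ρ : ℝ
  n₁ : ℕ
  n₂ : ℕ
  e₁ : ℝ
  m₁ : ℝ
  a₁ : ℝ
  b₁ : ℝ
  e₂ : ℝ
  m₂ : ℝ
  a₂ : ℝ
  b₂ : ℝ
  e₃ : ℝ
  m₃ : ℝ
  a₃ : ℝ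
  b₃ : ℝ

/-- the structural hypotheses of one hole with kink EXACTLY `t/10`. -/
def KcHyp (t : ℕ) (ρ e m a b : ℝ) : Prop :=
  0 ≤ a ∧ a ≤ ρ ∧ 0 ≤ b ∧ b ≤ ρ ∧ a + b = (t : ℝ) / 10 * ρ ∧ e - ρ ≤ m ∧ m ≤ e - a ∧ m ≤ e - b ∧ 187 / 2 ≤ m ∧ m < 140

/-- admissible configurations of the case: hole hypotheses, parity and size of the step counts, the window, the legs, the four parabolas. -/
def KcConf.Adm (cs : KcCase) (q : KcConf) : Prop :=
  KcHyp cs.t₁ q.ρ q.e₁ q.m₁ q.a₁ q.b₁ ∧ KcHyp cs.t₂ q.ρ q.e₂ q.m₂ q.a₂ q.b₂ ∧ KcHyp cs.t₃ q.ρ q.e₃ q.m₃ q.a₃ q.b₃ ∧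
    Even q.n₁ ∧ Even q.n₂ ∧ 1 ≤ q.n₁ ∧ 1 ≤ q.n₂ ∧ q.ρ * ((q.n₁ : ℝ) + q.n₂) ≤ 160 + 2 * q.ρ ∧
    q.a₁ * (2 * q.e₁ - q.a₁) + q.b₂ * (2 * q.e₂ - q.b₂) ≤ 2 * q.ρ ^ 2 * ((q.n₁ : ℝ) - 1) ∧
    q.a₂ * (2 * q.e₂ - q.a₂) + q.b₃ * (2 * q.e₃ - q.b₃) ≤ 2 * q.ρ ^ 2 * ((q.n₂ : ℝ) - 1) ∧
    q.e₂ ^ 2 ≤ q.e₁ ^ 2 - (q.n₁ : ℝ) * (q.a₁ * (2 * q.e₁ - q.a₁)) + q.ρ ^ 2 * q.n₁ * ((q.n₁ : ℝ) - 1) ∧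
    q.e₁ ^ 2 ≤ q.e₂ ^ 2 - (q.n₁ : ℝ) * (q.b₂ * (2 * q.e₂ - q.b₂)) + q.ρ ^ 2 * q.n₁ * ((q.n₁ : ℝ) - 1) ∧
    q.e₃ ^ 2 ≤ q.e₂ ^ 2 - (q.n₂ : ℝ) * (q.a₂ * (2 * q.e₂ - q.a₂)) + q.ρ ^ 2 * q.n₂ * ((q.n₂ : ℝ) - 1) ∧
    q.e₂ ^ 2 ≤ q.e₃ ^ 2 - (q.n₂ : ℝ) * (q.b₃ * (2 * q.e₃ - q.b₃)) + q.ρ ^ 2 * q.n₂ * ((q.n₂ : ℝ) - 1)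

/-- membership of one hole `(e, a, b)` in the hole state (every field a valid scaled bound). -/
def KcH.mem (h : KcH) (e a b : ℝ) : Prop :=
  (h.alo : ℝ) ≤ a * kcD ∧ a * kcD ≤ h.ahi ∧ (h.blo : ℝ) ≤ b * kcD ∧ b * kcD ≤ h.bhi ∧ (h.mx : ℝ) ≤ max a b * kcD ∧
    (h.elo : ℝ) ≤ e * kcD ∧ e * kcD ≤ h.ehi

/-- membership of a configuration in the state. -/
def KcS.mem (s : KcS) (q : KcConf) : Prop :=
  (s.rlo : ℝ) ≤ q.ρ * kcD ∧ q.ρ * kcD ≤ s.rhi ∧ s.h₁.mem q.e₁ q.a₁ q.b₁ ∧ s.h₂.mem q.e₂ q.a₂ q.b₂ ∧ s.h₃.mem q.e₃ q.a₃ q.b₃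

/-- the table charge of row `r`, column `c` (floored at `0`, as in `capK`). -/
def kcTabR (r c : ℕ) : ℝ := max 0 (((capKRows.getD r []).getD c 0 : ℚ) : ℝ)

/-- the clause the case certifies: the two non-key table charges are within the budget `E10/10`. -/
def KcGoal (cs : KcCase) (q : KcConf) : Prop :=
  if cs.p = 1 then kcTabR (capKRow q.m₂) cs.c₂ + kcTabR (capKRow q.m₃) cs.c₃ ≤ (cs.E10 : ℝ) / 10
  else kcTabR (capKRow q.m₁) cs.c₁ + kcTabR (capKRow q.m₃) cs.c₃ ≤ (cs.E10 : ℝ) / 10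

/-- validity of the case data used by the soundness theorem. -/
def KcCase.Valid (cs : KcCase) : Prop := 10 ≤ cs.t₁ ∧ 10 ≤ cs.t₂ ∧ 10 ≤ cs.t₃ ∧ cs.c₁ ≤ 12 ∧ cs.c₂ ≤ 12 ∧ cs.c₃ ≤ 12

/-! ## §S4 Tightening, root and splits preserve membership -/

/-- `kc_le_cast_min` (docstring added by the landing lane; see the module docstring). [formal bookkeeping] -/
theorem kc_le_cast_min {z : ℝ} {x y : ℕ} (h1 : z ≤ x) (h2 : z ≤ y) : z ≤ ((min x y : ℕ) : ℝ) := by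
  rcases le_total x y with h | h
  · rw [min_eq_left h]; exact h1
  · rw [min_eq_right h]; exact h2

/-- `kc_cast_max_le` (docstring added by the landing lane; see the module docstring). [formal bookkeeping] -/
theorem kc_cast_max_le {z : ℝ} {x y : ℕ} (h1 : (x : ℝ) ≤ z) (h2 : (y : ℝ) ≤ z) : ((max x y : ℕ) : ℝ) ≤ z := by
  rcases le_total x y with h | h
  · rw [max_eq_right h]; exact h2
  · rw [max_eq_left h]; exact h1

/-- ★ re-tightening is sound: it reads only the `a`- and `e`-bounds of the hole and the `ρ`-bounds. -/
theorem kcTight_mem {t rlo rhi : ℕ} (ht : 10 ≤ t) {h : KcH} {ρ e m a b : ℝ} (hy : KcHyp t ρ e m a b)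
    (hr : (rlo : ℝ) ≤ ρ * kcD ∧ ρ * kcD ≤ rhi) (ha : (h.alo : ℝ) ≤ a * kcD ∧ a * kcD ≤ h.ahi)
    (he : (h.elo : ℝ) ≤ e * kcD ∧ e * kcD ≤ h.ehi) : (kcTight t rlo rhi h).mem e a b := by
  have hD := kcD_pos
  obtain ⟨ha0, haρ, hb0, hbρ, hab, hm1, hm2, hm3, hm4, hm5⟩ := hy
  obtain ⟨hr1, hr2⟩ := hr
  obtain ⟨ha1, ha2⟩ := ha
  obtain ⟨he1, he2⟩ := he
  have ht' : (10 : ℝ) ≤ t := by exact_mod_cast ht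
  have haD : 0 ≤ a * kcD := mul_nonneg ha0 hD.le
  have hbD0 : 0 ≤ b * kcD := mul_nonneg hb0 hD.le
  have hkr : ((t * rlo / 10 : ℕ) : ℝ) ≤ (t : ℝ) / 10 * rlo := by
    have := kc_cast_div10_le (t * rlo); push_cast at this; linarith only [this]
  have hKr : (t : ℝ) / 10 * rlo ≤ (t : ℝ) / 10 * (ρ * kcD) := mul_le_mul_of_nonneg_left hr1 (by linarith only [ht'])
  have hKr' : ((t : ℝ) / 10 - 1) * rlo ≤ ((t : ℝ) / 10 - 1) * (ρ * kcD) :=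
    mul_le_mul_of_nonneg_left hr1 (by linarith only [ht'])
  have hKhi : (t : ℝ) / 10 * (ρ * kcD) ≤ (t : ℝ) / 10 * rhi := mul_le_mul_of_nonneg_left hr2 (by linarith only [ht'])
  have hce : (t : ℝ) / 10 * rhi ≤ (((t * rhi + 9) / 10 : ℕ) : ℝ) := by
    have := kc_le_cast_cdiv10 (t * rhi); push_cast at this; linarith only [this]
  have hbD : b * kcD = (t : ℝ) / 10 * (ρ * kcD) - a * kcD := by
    have : b = (t : ℝ) / 10 * ρ - a := by linarith only [hab]
    rw [this]; ring
  have haK : ((t : ℝ) / 10 - 1) * (ρ * kcD) ≤ a * kcD := by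
    have h1 : ((t : ℝ) / 10 - 1) * ρ ≤ a := by linarith only [hab, hbρ]
    have h2 := mul_le_mul_of_nonneg_right h1 hD.le
    linarith only [h2]
  have hbK : ((t : ℝ) / 10 - 1) * (ρ * kcD) ≤ b * kcD := by
    have h1 : ((t : ℝ) / 10 - 1) * ρ ≤ b := by linarith only [hab, haρ]
    have h2 := mul_le_mul_of_nonneg_right h1 hD.le
    linarith only [h2]
  -- the new bounds, stated on the syntactic forms of `kcTight`
  have hA1 : ((max h.alo (t * rlo / 10 - rlo) : ℕ) : ℝ) ≤ a * kcD :=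
    kc_cast_max_le ha1 (kc_cast_tsub_le haD (by linarith only [hkr, hKr', haK]))
  have haρD : a * kcD ≤ ρ * kcD := mul_le_mul_of_nonneg_right haρ hD.le
  have hbρD : b * kcD ≤ ρ * kcD := mul_le_mul_of_nonneg_right hbρ hD.le
  have hA2 : a * kcD ≤ ((min h.ahi rhi : ℕ) : ℝ) := kc_le_cast_min ha2 (by linarith only [haρD, hr2])
  have hB1 : ((max (t * rlo / 10 - min h.ahi rhi) (t * rlo / 10 - rlo) : ℕ) : ℝ) ≤ b * kcD :=
    kc_cast_max_le (kc_cast_tsub_le hbD0 (by linarith only [hbD, hkr, hKr, hA2]))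
      (kc_cast_tsub_le hbD0 (by linarith only [hkr, hKr', hbK]))
  have hB2 : b * kcD ≤ ((min rhi ((t * rhi + 9) / 10 - max h.alo (t * rlo / 10 - rlo)) : ℕ) : ℝ) :=
    kc_le_cast_min (by linarith only [hbρD, hr2])
      (kc_le_cast_tsub (by linarith only [hbD, hKhi, hce, hA1]))
  have hM : ((max (max h.alo (t * rlo / 10 - rlo)) (max (t * rlo / 10 - min h.ahi rhi) (t * rlo / 10 - rlo)) : ℕ) : ℝ) ≤
      max a b * kcD :=
    kc_cast_max_le (le_trans hA1 (mul_le_mul_of_nonneg_right (le_max_left _ _) hD.le))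
      (le_trans hB1 (mul_le_mul_of_nonneg_right (le_max_right _ _) hD.le))
  have hE1 : ((max h.elo (kcEMIN + max (max h.alo (t * rlo / 10 - rlo))
      (max (t * rlo / 10 - min h.ahi rhi) (t * rlo / 10 - rlo))) : ℕ) : ℝ) ≤ e * kcD := by
    refine kc_cast_max_le he1 ?_
    rw [Nat.cast_add, kcEMIN_eq]
    have h1 : max a b * kcD ≤ (e - 187 / 2) * kcD :=
      mul_le_mul_of_nonneg_right (max_le (by linarith only [hm2, hm4]) (by linarith only [hm3, hm4])) hD.le
    linarith only [hM, h1]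
  have hE2 : e * kcD ≤ ((min h.ehi (kcETOP + rhi) : ℕ) : ℝ) := by
    refine kc_le_cast_min he2 ?_
    rw [Nat.cast_add, kcETOP_eq]
    have h1 : e * kcD ≤ (140 + ρ) * kcD := mul_le_mul_of_nonneg_right (by linarith only [hm1, hm5]) hD.le
    linarith only [h1, hr2]
  unfold kcTight KcH.mem
  dsimp only
  exact ⟨hA1, hA2, hB1, hB2, hM, hE1, hE2⟩

/-- the root state contains every admissible configuration with `ρ·D ∈ [rlo, rhi]`. -/
theorem kcRoot_mem {cs : KcCase} (hv : cs.Valid) {rlo rhi : ℕ} {q : KcConf} (hq : q.Adm cs)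
    (hr : (rlo : ℝ) ≤ q.ρ * kcD ∧ q.ρ * kcD ≤ rhi) : (kcRoot cs rlo rhi).mem q := by
  have hD := kcD_pos
  obtain ⟨hy1, hy2, hy3, -⟩ := hq
  obtain ⟨ht1, ht2, ht3, -⟩ := hv
  have raw : ∀ {t : ℕ} {e m a b : ℝ}, KcHyp t q.ρ e m a b →
      (((⟨0, rhi, 0, rhi, 0, 0, kcETOP + rhi⟩ : KcH).alo : ℝ) ≤ a * kcD ∧ a * kcD ≤ (⟨0, rhi, 0, rhi, 0, 0, kcETOP + rhi⟩ : KcH).ahi) ∧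
      (((⟨0, rhi, 0, rhi, 0, 0, kcETOP + rhi⟩ : KcH).elo : ℝ) ≤ e * kcD ∧ e * kcD ≤ (⟨0, rhi, 0, rhi, 0, 0, kcETOP + rhi⟩ : KcH).ehi) := by
    intro t e m a b hy
    obtain ⟨ha0, haρ, hb0, hbρ, hab, hm1, hm2, hm3, hm4, hm5⟩ := hy
    refine ⟨⟨by push_cast; nlinarith, by push_cast; nlinarith⟩, ⟨by push_cast; nlinarith, ?_⟩⟩
    push_cast; rw [kcETOP_eq]; nlinarith
  unfold kcRoot KcS.mem
  exact ⟨hr.1, hr.2, kcTight_mem ht1 hy1 hr (raw hy1).1 (raw hy1).2, kcTight_mem ht2 hy2 hr (raw hy2).1 (raw hy2).2,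
    kcTight_mem ht3 hy3 hr (raw hy3).1 (raw hy3).2⟩

/-- ★ a split covers its parent: every member of `s` is a member of one of the two children. -/
theorem kcSplit_mem {cs : KcCase} (hv : cs.Valid) {s : KcS} {q : KcConf} (hq : q.Adm cs) (hs : s.mem q) (ax : ℕ) :
    (kcSplit cs s ax).1.mem q ∨ (kcSplit cs s ax).2.mem q := by
  have hD := kcD_pos
  obtain ⟨hy1, hy2, hy3, -⟩ := hq
  obtain ⟨ht1, ht2, ht3, -⟩ := hv
  obtain ⟨hr1, hr2, hm1, hm2, hm3⟩ := hs
  have hr : (s.rlo : ℝ) ≤ q.ρ * kcD ∧ q.ρ * kcD ≤ s.rhi := ⟨hr1, hr2⟩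
  unfold kcSplit
  by_cases h0 : ax = 0
  · simp only [h0, if_true]
    obtain ⟨x1, x2, x3, x4, x5, x6, x7⟩ := hm1
    rcases le_total (q.e₁ * kcD) (((s.h₁.elo + s.h₁.ehi) / 2 : ℕ) : ℝ) with h | h
    · left; exact ⟨hr1, hr2, ⟨x1, x2, x3, x4, x5, x6, h⟩, hm2, hm3⟩
    · right; exact ⟨hr1, hr2, ⟨x1, x2, x3, x4, x5, h, x7⟩, hm2, hm3⟩
  by_cases h1 : ax = 1
  · simp only [h1, if_true, show (1 : ℕ) ≠ 0 by decide, if_false]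
    obtain ⟨x1, x2, x3, x4, x5, x6, x7⟩ := hm2
    rcases le_total (q.e₂ * kcD) (((s.h₂.elo + s.h₂.ehi) / 2 : ℕ) : ℝ) with h | h
    · left; exact ⟨hr1, hr2, hm1, ⟨x1, x2, x3, x4, x5, x6, h⟩, hm3⟩
    · right; exact ⟨hr1, hr2, hm1, ⟨x1, x2, x3, x4, x5, h, x7⟩, hm3⟩
  by_cases h2 : ax = 2
  · simp only [h2, show (2 : ℕ) ≠ 0 by decide, show (2 : ℕ) ≠ 1 by decide, if_true, if_false]
    obtain ⟨x1, x2, x3, x4, x5, x6, x7⟩ := hm3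
    rcases le_total (q.e₃ * kcD) (((s.h₃.elo + s.h₃.ehi) / 2 : ℕ) : ℝ) with h | h
    · left; exact ⟨hr1, hr2, hm1, hm2, ⟨x1, x2, x3, x4, x5, x6, h⟩⟩
    · right; exact ⟨hr1, hr2, hm1, hm2, ⟨x1, x2, x3, x4, x5, h, x7⟩⟩
  by_cases h3 : ax = 3
  · simp only [h3, show (3 : ℕ) ≠ 0 by decide, show (3 : ℕ) ≠ 1 by decide, show (3 : ℕ) ≠ 2 by decide, if_true, if_false]
    obtain ⟨x1, x2, x3, x4, x5, x6, x7⟩ := hm1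
    rcases le_total (q.a₁ * kcD) (((s.h₁.alo + s.h₁.ahi) / 2 : ℕ) : ℝ) with h | h
    · left; exact ⟨hr1, hr2, kcTight_mem ht1 hy1 hr ⟨x1, h⟩ ⟨x6, x7⟩, hm2, hm3⟩
    · right; exact ⟨hr1, hr2, kcTight_mem ht1 hy1 hr ⟨h, x2⟩ ⟨x6, x7⟩, hm2, hm3⟩
  by_cases h4 : ax = 4
  · simp only [h4, show (4 : ℕ) ≠ 0 by decide, show (4 : ℕ) ≠ 1 by decide, show (4 : ℕ) ≠ 2 by decide,
      show (4 : ℕ) ≠ 3 by decide, if_true, if_false]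
    obtain ⟨x1, x2, x3, x4, x5, x6, x7⟩ := hm2
    rcases le_total (q.a₂ * kcD) (((s.h₂.alo + s.h₂.ahi) / 2 : ℕ) : ℝ) with h | h
    · left; exact ⟨hr1, hr2, hm1, kcTight_mem ht2 hy2 hr ⟨x1, h⟩ ⟨x6, x7⟩, hm3⟩
    · right; exact ⟨hr1, hr2, hm1, kcTight_mem ht2 hy2 hr ⟨h, x2⟩ ⟨x6, x7⟩, hm3⟩
  by_cases h5 : ax = 5
  · simp only [h5, show (5 : ℕ) ≠ 0 by decide, show (5 : ℕ) ≠ 1 by decide, show (5 : ℕ) ≠ 2 by decide,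
      show (5 : ℕ) ≠ 3 by decide, show (5 : ℕ) ≠ 4 by decide, if_true, if_false]
    obtain ⟨x1, x2, x3, x4, x5, x6, x7⟩ := hm3
    rcases le_total (q.a₃ * kcD) (((s.h₃.alo + s.h₃.ahi) / 2 : ℕ) : ℝ) with h | h
    · left; exact ⟨hr1, hr2, hm1, hm2, kcTight_mem ht3 hy3 hr ⟨x1, h⟩ ⟨x6, x7⟩⟩
    · right; exact ⟨hr1, hr2, hm1, hm2, kcTight_mem ht3 hy3 hr ⟨h, x2⟩ ⟨x6, x7⟩⟩
  simp only [h0, h1, h2, h3, h4, h5, if_false]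
  obtain ⟨x1, x2, x3, x4, x5, x6, x7⟩ := hm1
  obtain ⟨y1, y2, y3, y4, y5, y6, y7⟩ := hm2
  obtain ⟨z1, z2, z3, z4, z5, z6, z7⟩ := hm3
  rcases le_total (q.ρ * kcD) (((s.rlo + s.rhi) / 2 : ℕ) : ℝ) with h | h
  · left
    exact ⟨hr1, h, kcTight_mem ht1 hy1 ⟨hr1, h⟩ ⟨x1, x2⟩ ⟨x6, x7⟩, kcTight_mem ht2 hy2 ⟨hr1, h⟩ ⟨y1, y2⟩ ⟨y6, y7⟩,
      kcTight_mem ht3 hy3 ⟨hr1, h⟩ ⟨z1, z2⟩ ⟨z6, z7⟩⟩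
  · right
    exact ⟨h, hr2, kcTight_mem ht1 hy1 ⟨h, hr2⟩ ⟨x1, x2⟩ ⟨x6, x7⟩, kcTight_mem ht2 hy2 ⟨h, hr2⟩ ⟨y1, y2⟩ ⟨y6, y7⟩,
      kcTight_mem ht3 hy3 ⟨h, hr2⟩ ⟨z1, z2⟩ ⟨z6, z7⟩⟩


/-! ## §S5 The L leaf (joint leg budget) -/

/-- the candidate function of the L test: `Ψ(x) = x(2E₀ - x) + β(2E₀ - β)`, `β = max (blo, kr - x)`. -/
def kcPsi (blo kr E₀ x : ℝ) : ℝ := x * (2 * E₀ - x) + max blo (kr - x) * (2 * E₀ - max blo (kr - x))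

/-- ★ `Ψ` is concave on each of its two pieces, so on `[alo, ahi]` it is at least the least of its values at the two ends and at
the (clamped) breakpoint `kr - blo`. -/
theorem kc_psi_three {alo ahi blo kr E₀ X : ℝ} (h1 : alo ≤ X) (h2 : X ≤ ahi) :
    min (kcPsi blo kr E₀ alo) (min (kcPsi blo kr E₀ ahi) (kcPsi blo kr E₀ (min (max (kr - blo) alo) ahi))) ≤
      kcPsi blo kr E₀ X := by
  rcases le_total X (kr - blo) with hA | hB
  · have hx3 : min (max (kr - blo) alo) ahi = min (kr - blo) ahi := by rw [max_eq_left (le_trans h1 hA)]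
    have e1 : ∀ x, x ≤ kr - blo → kcPsi blo kr E₀ x = (-2) * x * x + (2 * kr) * x + (2 * E₀ * kr - kr * kr) := by
      intro x hx; unfold kcPsi; rw [max_eq_right (by linarith)]; ring
    have hX3 : X ≤ min (kr - blo) ahi := le_min hA h2
    have key := kc_concave_min (p := -2) (q := 2 * kr) (r := 2 * E₀ * kr - kr * kr) (by norm_num) h1 hX3
    rw [← e1 alo (le_trans h1 hA), ← e1 _ (min_le_left _ _), ← e1 X hA] at key
    rw [hx3]
    exact le_trans (min_le_min le_rfl (min_le_right _ _)) key
  · have e2 : ∀ x, kr - blo ≤ x → kcPsi blo kr E₀ x = (-1) * x * x + (2 * E₀) * x + blo * (2 * E₀ - blo) := by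
      intro x hx; unfold kcPsi; rw [max_eq_left (by linarith)]; ring
    have hL : max alo (kr - blo) ≤ X := max_le h1 hB
    have key := kc_concave_min (p := -1) (q := 2 * E₀) (r := blo * (2 * E₀ - blo)) (by norm_num) hL h2
    rw [← e2 X hB, ← e2 ahi (le_trans hB h2), ← e2 _ (le_max_right _ _)] at key
    rcases le_total (kr - blo) alo with hc | hc
    · rw [max_eq_left hc] at key
      exact le_trans (min_le_min le_rfl (min_le_left _ _)) key
    · rw [max_eq_right hc] at key
      have hx3 : min (max (kr - blo) alo) ahi = kr - blo := by rw [max_eq_left hc, min_eq_left (le_trans hB h2)]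
      rw [hx3]
      calc _ ≤ min (kcPsi blo kr E₀ ahi) (kcPsi blo kr E₀ (kr - blo)) := min_le_right _ _
        _ = min (kcPsi blo kr E₀ (kr - blo)) (kcPsi blo kr E₀ ahi) := min_comm _ _
        _ ≤ _ := key

/-- `kc_beta_cast` (docstring added by the landing lane; see the module docstring). [formal bookkeeping] -/
theorem kc_beta_cast (blo kr x : ℕ) : ((max blo (kr - x) : ℕ) : ℝ) = max (blo : ℝ) ((kr : ℝ) - x) := by
  rcases le_total x kr with h | h
  · rw [Nat.cast_max, Nat.cast_sub h]
  · rw [Nat.sub_eq_zero_of_le h, Nat.max_eq_left (Nat.zero_le _)]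
    have : (kr : ℝ) ≤ x := by exact_mod_cast h
    rw [max_eq_left (by linarith [(Nat.cast_nonneg blo : (0 : ℝ) ≤ blo)])]

/-- `kc_x3_cast` (docstring added by the landing lane; see the module docstring). [formal bookkeeping] -/
theorem kc_x3_cast (kr blo alo ahi : ℕ) :
    ((min (max (kr - blo) alo) ahi : ℕ) : ℝ) = min (max ((kr : ℝ) - blo) alo) ahi := by
  rcases le_total blo kr with h | h
  · rw [Nat.cast_min, Nat.cast_max, Nat.cast_sub h]
  · rw [Nat.sub_eq_zero_of_le h, Nat.max_eq_right (Nat.zero_le _), Nat.cast_min]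
    have : (kr : ℝ) ≤ blo := by exact_mod_cast h
    rw [max_eq_right (by linarith [(Nat.cast_nonneg alo : (0 : ℝ) ≤ alo)])]

/-- one verified candidate, read in `ℝ`. -/
theorem kc_leafLAt_real {t₂ : ℕ} {s : KcS} {x : ℕ} (h : kcLeafLAt t₂ s x = true) (hN : 2 ≤ kcNmax s.rlo) :
    2 * ((s.rhi : ℝ) * s.rhi) * ((kcNmax s.rlo : ℝ) - 2) + (s.h₁.alo : ℝ) * s.h₁.alo + (s.h₃.blo : ℝ) * s.h₃.blo <
      2 * (s.h₁.alo : ℝ) * s.h₁.elo + 2 * (s.h₃.blo : ℝ) * s.h₃.elo + kcPsi s.h₂.blo ((t₂ * s.rlo / 10 : ℕ) : ℝ) s.h₂.elo x := by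
  unfold kcLeafLAt at h
  dsimp only at h
  have h1 := of_decide_eq_true h
  have hb := kc_beta_cast s.h₂.blo (t₂ * s.rlo / 10) x
  have hc : ((kcNmax s.rlo - 2 : ℕ) : ℝ) = (kcNmax s.rlo : ℝ) - 2 := by rw [Nat.cast_sub hN]; norm_num
  generalize hB : max s.h₂.blo (t₂ * s.rlo / 10 - x) = B at h1 hb
  generalize hM : kcNmax s.rlo - 2 = M at h1 hc
  have h2 : (2 : ℝ) * (s.rhi * s.rhi) * M + s.h₁.alo * s.h₁.alo + s.h₃.blo * s.h₃.blo + x * x + B * B <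
      2 * s.h₁.alo * s.h₁.elo + 2 * s.h₃.blo * s.h₃.elo + 2 * x * s.h₂.elo + 2 * B * s.h₂.elo := by exact_mod_cast h1
  rw [hc] at h2
  unfold kcPsi; rw [← hb]
  linarith

/-- a scaled leg: `A·D² = (aD)(2eD - aD)`. -/
theorem kc_scale_sq (a e : ℝ) : a * (2 * e - a) * ((kcD : ℝ) * kcD) = a * kcD * (2 * (e * kcD) - a * kcD) := by ring

/-- ★ an L leaf admits no admissible configuration. -/
theorem kcLeafL_false {cs : KcCase} (hv : cs.Valid) {s : KcS} (h : kcLeafL cs.t₂ s = true) {q : KcConf} (hq : q.Adm cs)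
    (hs : s.mem q) : False := by
  have hD := kcD_pos
  simp only [kcLeafL, Bool.and_eq_true, decide_eq_true_eq] at h
  obtain ⟨⟨⟨hr0, c1⟩, c2⟩, c3⟩ := h
  obtain ⟨hy1, hy2, hy3, hev1, hev2, hn1, hn2, hwin, hleg1, hleg2, -, -, -, -⟩ := hq
  obtain ⟨hr1, hr2, ⟨x1, x2, x3, x4, x5, x6, x7⟩, ⟨y1, y2, y3, y4, y5, y6, y7⟩, ⟨z1, z2, z3, z4, z5, z6, z7⟩⟩ := hs
  obtain ⟨ha1, _, _, _, _, _, hm12, _, hm14, _⟩ := hy1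
  obtain ⟨ha2, _, hb2, _, hab2, _, hm22, hm23, hm24, _⟩ := hy2
  obtain ⟨_, _, hb3, _, _, _, _, hm33, hm34, _⟩ := hy3
  obtain ⟨-, ht2, -⟩ := hv
  -- the window
  have hN : q.n₁ + q.n₂ ≤ kcNmax s.rlo :=
    kc_le_nmax hr0 hr1 (Even.add hev1 hev2) (by push_cast; exact hwin)
  have hN2 : 2 ≤ kcNmax s.rlo := by omega
  have hNr : ((q.n₁ : ℝ) - 1) + ((q.n₂ : ℝ) - 1) ≤ (kcNmax s.rlo : ℝ) - 2 := by
    have : ((q.n₁ + q.n₂ : ℕ) : ℝ) ≤ kcNmax s.rlo := by exact_mod_cast hN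
    push_cast at this; linarith
  -- candidates in ℝ
  have d1 := kc_leafLAt_real c1 hN2
  have d2 := kc_leafLAt_real c2 hN2
  have d3 := kc_leafLAt_real c3 hN2
  rw [kc_x3_cast] at d3
  set kr : ℝ := ((cs.t₂ * s.rlo / 10 : ℕ) : ℝ) with hkr_def
  set E₀ : ℝ := (s.h₂.elo : ℝ)
  -- Ψ(X₂) ≤ scaled A₂ + B₂
  have hρD0 : 0 < q.ρ * kcD := lt_of_lt_of_le (by exact_mod_cast hr0) hr1
  have ht' : (10 : ℝ) ≤ cs.t₂ := by exact_mod_cast ht2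
  have hkr : kr ≤ (cs.t₂ : ℝ) / 10 * (q.ρ * kcD) := by
    have h1 := kc_cast_div10_le (cs.t₂ * s.rlo); push_cast at h1
    have h2 : (cs.t₂ : ℝ) / 10 * s.rlo ≤ (cs.t₂ : ℝ) / 10 * (q.ρ * kcD) :=
      mul_le_mul_of_nonneg_left hr1 (by linarith only [ht'])
    rw [hkr_def]; linarith only [h1, h2]
  have hY : q.b₂ * kcD = (cs.t₂ : ℝ) / 10 * (q.ρ * kcD) - q.a₂ * kcD := by
    have : q.b₂ = (cs.t₂ : ℝ) / 10 * q.ρ - q.a₂ := by linarith only [hab2]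
    rw [this]; ring
  have hβY : max (s.h₂.blo : ℝ) (kr - q.a₂ * kcD) ≤ q.b₂ * kcD := max_le y3 (by linarith only [hkr, hY])
  have hβ0 : 0 ≤ max (s.h₂.blo : ℝ) (kr - q.a₂ * kcD) := le_trans (Nat.cast_nonneg _) (le_max_left _ _)
  have hYE : q.b₂ * kcD ≤ q.e₂ * kcD := mul_le_mul_of_nonneg_right (by linarith only [hm23, hm24]) hD.le
  have hXE : q.a₂ * kcD ≤ q.e₂ * kcD := mul_le_mul_of_nonneg_right (by linarith only [hm22, hm24]) hD.le
  have hX0 : 0 ≤ q.a₂ * kcD := mul_nonneg ha2 hD.le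
  have hΨ : kcPsi s.h₂.blo kr E₀ (q.a₂ * kcD) ≤
      q.a₂ * kcD * (2 * (q.e₂ * kcD) - q.a₂ * kcD) + q.b₂ * kcD * (2 * (q.e₂ * kcD) - q.b₂ * kcD) := by
    have h1 := kc_mono_sq hβ0 hβY hYE y6
    have h2 : q.a₂ * kcD * (2 * E₀ - q.a₂ * kcD) ≤ q.a₂ * kcD * (2 * (q.e₂ * kcD) - q.a₂ * kcD) :=
      mul_le_mul_of_nonneg_left (by linarith only [y6]) hX0
    unfold kcPsi; linarith only [h1, h2]
  have h3 := kc_psi_three (blo := (s.h₂.blo : ℝ)) (kr := kr) (E₀ := E₀) y1 y2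
  -- lower bounds of A₁ and B₃
  have hA1 : (s.h₁.alo : ℝ) * (2 * s.h₁.elo - s.h₁.alo) ≤ q.a₁ * kcD * (2 * (q.e₁ * kcD) - q.a₁ * kcD) :=
    kc_mono_sq (Nat.cast_nonneg _) x1 (mul_le_mul_of_nonneg_right (by linarith only [hm12, hm14]) hD.le) x6
  have hB3 : (s.h₃.blo : ℝ) * (2 * s.h₃.elo - s.h₃.blo) ≤ q.b₃ * kcD * (2 * (q.e₃ * kcD) - q.b₃ * kcD) :=
    kc_mono_sq (Nat.cast_nonneg _) z3 (mul_le_mul_of_nonneg_right (by linarith only [hm33, hm34]) hD.le) z6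
  -- the legs, scaled
  have hD2 : (0 : ℝ) ≤ (kcD : ℝ) * kcD := by positivity
  have hL1 : q.a₁ * kcD * (2 * (q.e₁ * kcD) - q.a₁ * kcD) + q.b₂ * kcD * (2 * (q.e₂ * kcD) - q.b₂ * kcD) ≤
      2 * ((q.ρ * kcD) * (q.ρ * kcD)) * ((q.n₁ : ℝ) - 1) := by
    have := mul_le_mul_of_nonneg_right hleg1 hD2
    rw [add_mul, kc_scale_sq, kc_scale_sq] at this
    linarith only [this, show 2 * q.ρ ^ 2 * ((q.n₁ : ℝ) - 1) * ((kcD : ℝ) * kcD) =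
      2 * ((q.ρ * kcD) * (q.ρ * kcD)) * ((q.n₁ : ℝ) - 1) by ring]
  have hL2 : q.a₂ * kcD * (2 * (q.e₂ * kcD) - q.a₂ * kcD) + q.b₃ * kcD * (2 * (q.e₃ * kcD) - q.b₃ * kcD) ≤
      2 * ((q.ρ * kcD) * (q.ρ * kcD)) * ((q.n₂ : ℝ) - 1) := by
    have := mul_le_mul_of_nonneg_right hleg2 hD2
    rw [add_mul, kc_scale_sq, kc_scale_sq] at this
    linarith only [this, show 2 * q.ρ ^ 2 * ((q.n₂ : ℝ) - 1) * ((kcD : ℝ) * kcD) =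
      2 * ((q.ρ * kcD) * (q.ρ * kcD)) * ((q.n₂ : ℝ) - 1) by ring]
  -- ρD ≤ rhi and the window bound
  have hρ2 : (q.ρ * kcD) * (q.ρ * kcD) ≤ (s.rhi : ℝ) * s.rhi := mul_le_mul hr2 hr2 hρD0.le (Nat.cast_nonneg _)
  have hn1' : (1 : ℝ) ≤ q.n₁ := by exact_mod_cast hn1
  have hn2' : (1 : ℝ) ≤ q.n₂ := by exact_mod_cast hn2
  have hsum0 : 0 ≤ ((q.n₁ : ℝ) - 1) + ((q.n₂ : ℝ) - 1) := by linarith only [hn1', hn2']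
  have hT : 2 * ((q.ρ * kcD) * (q.ρ * kcD)) * (((q.n₁ : ℝ) - 1) + ((q.n₂ : ℝ) - 1)) ≤
      2 * ((s.rhi : ℝ) * s.rhi) * ((kcNmax s.rlo : ℝ) - 2) := by
    have h1 : 2 * ((q.ρ * kcD) * (q.ρ * kcD)) * (((q.n₁ : ℝ) - 1) + ((q.n₂ : ℝ) - 1)) ≤
        2 * ((s.rhi : ℝ) * s.rhi) * (((q.n₁ : ℝ) - 1) + ((q.n₂ : ℝ) - 1)) :=
      mul_le_mul_of_nonneg_right (by linarith only [hρ2]) hsum0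
    have h2 : 2 * ((s.rhi : ℝ) * s.rhi) * (((q.n₁ : ℝ) - 1) + ((q.n₂ : ℝ) - 1)) ≤
        2 * ((s.rhi : ℝ) * s.rhi) * ((kcNmax s.rlo : ℝ) - 2) :=
      mul_le_mul_of_nonneg_left hNr (by positivity)
    linarith only [h1, h2]
  -- contradiction
  have hmin := lt_min d1 (lt_min d2 d3)
  rw [min_add_add_left, min_add_add_left] at hmin
  linarith only [hmin, h3, hΨ, hA1, hB3, hL1, hL2, hT]

end Summit.AtomisticToContinuum.Crystallization.Theorems.ChargedEnergyGapChartDial
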